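import Literature.AlgebraicGeometry.Frobenioids.Thm36SubPerfectionUnitsQ
import Literature.AlgebraicGeometry.Frobenioids.ArchimedeanAutActionReadings
import HarnessLib

/-!
# Frobenioids II, Thm. 3.6 (iv), second sentence (both repaired readings) for `C^ℚ := C^pf` — PROVED over
# THE perfection of the archimedean Frobenioid (slot `Thm36Sub.ivReadings_Q`)

Mochizuki, *The geometry of Frobenioids II: poly-Frobenioids*, Kyushu J. Math. **62** (2008) 401–460, §3,
Thm. 3.6 (iv) p. 37 (kurims text `paper:url-4322d76898e0`): "(iv) Let `A ∈ Ob(F)`; `A_D := Base(A) ∈ Ob(D)`.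
Write `A₀ ∈ Ob(D₀)` for the image of `A_D` in `D₀`. Then the natural action of `Aut_F(A)` on `O^▷(A), O^×(A)`
factors through `Aut_{D₀}(A₀)`. If, moreover, `Λ ∈ {ℤ, ℚ}`, then this factorization determines a faithful
action of the image of `Aut_F(A)` in `Aut_{D₀}(A₀)` on `O^▷(A), O^×(A)`." [cite: MochizukiFrdII2008, Thm 3.6 (iv) p.37]
— the SECOND sentence, in the two REPAIRED READINGS of the L1 layer ruling 2026-08-25T19:26:58Z (the printed
sentence is flag L1 #6, false as printed at `Λ = ℤ`; readings (3) `ArchFrd.Thm36iv_faithful_of_isIsotropic` and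
(1) `ArchFrd.Thm36iv_faithful_istr` of `ArchimedeanBasicProperties.lean`), for `F = C^ℚ := C^pf`, THE
perfection of the archimedean Frobenioid `C → F_Φ` of Example 3.3 over any base `π : D → D₀`.

PROOF companion (abc-iut cell, layer L1, `SUBDAG-FrdII-Thm36-Prop35`, row M13 slot `Thm36Sub.ivReadings_Q`
of `Thm36Sub.lean`; seat abc-iut-w5-d237, handed over by abc-iut-w5-d190) over the unit colimit
`O^×((A, n)) = lim_→ (O^×(A^{(c)}), z ↦ z^{c′/c}) ≅ S¹ ⊗_ℤ ℚ` of `Thm36SubPerfectionUnits(Q).lean`: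
* an automorphism `α` of `X = (A, n)` is the class `[Θ]` of an automorphism `Θ` of a Frobenius power
  `A^{(c)}` ([FrdI] Prop. 3.2 (ii)); its Galois twist `autTwist Θ ∈ {id, conj}` (the `D₀`-arrow under
  `Base(Θ)`) does not change under transport and determines the image of `α` in `Aut_{D₀}(X₀)`
  (`mapIso_eq_of_autTwist_eq`);
* conjugation by `α` sends a unit `[θ]` to `[Θ θ Θ⁻¹]`, whose scalar is the twist of `Θ` applied to the
  scalar of `θ` (Ex. 3.3 (i) composition law, abc-iut-L1-t9's `AutAction.scalar_conj`); on the values in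
  `S¹ ⊗_ℤ ℚ` this is `v ↦ v` or `v ↦ -v` (complex conjugation = inversion on `S¹`; `unitVal_conj`);
* hence, for `A` complex, automorphisms acting identically on `O^×(X)` have the same twist
  (`autTwist_eq_of_units`): otherwise `v = -v` for every value, every unit is `2`-torsion, so trivial
  (`eq_one_of_isOfFinOrder`), contradicting `unitsSubgroup_ne_bot_of_isComplex`; for `A` real
  `Aut_{D₀}(Spec ℝ)` is trivial — this is reading (3) for `C^ℚ` (`faithful_of_isIsotropic_Q`); reading (1)
  follows by abc-iut-w4-d103's generic `thm36iv_faithful_istr_of_faithful_of_isIsotropic`;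
* `ivReadings_Q_holds` closes the slot (for every value of its parameter `hF`), and abc-iut-L1-t9's instance
  `Thm36iv_readings_CA π (pfCompletion hF) rlf` holds in full (`thm36iv_readings_CA_pfCompletion`; its only
  residue was reading (3) for the perfection datum, `thm36iv_readings_CA_of_pf`).
One auxiliary `def` (`autTwist`, a `Bool` read off existing data); no notion of the paper is (re)defined, no
statement strengthened; nothing here bears on [IUTchIII] Cor. 3.12.
-/

noncomputable section

namespace Literature.AlgebraicGeometry.Frobenioids

open CategoryTheory Opposite
open scoped TensorProduct

universe v u

namespace ArchFrd

namespace Thm36Sub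

/-! ### Small tools on `D₀` and `S¹` -/

/-- Endomorphisms of a real object of `D₀` coincide (`Aut_{D₀}(Spec ℝ)` is trivial).
[cite: MochizukiFrdII2008, Def 3.1 (i) p.23] -/
theorem D0_endo_eq_of_isReal {K : D0} (hK : K.IsReal) (f g : K ⟶ K) : f = g := by
  unfold D0.IsReal at hK
  subst hK
  exact Subsingleton.elim _ _

/-- Twists of composable arrows into a complex object multiply (`xor`). [cite: MochizukiFrdII2008, Def 3.1 (i) p.23] -/
theorem twists_comp_of_isComplex {M L K : D0} (hK : K.IsComplex) (f : M ⟶ L) (g : L ⟶ K) :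
    D0.Hom.twists (f ≫ g) = xor (D0.Hom.twists f) (D0.Hom.twists g) := by
  unfold D0.IsComplex at hK
  subst hK
  exact D0.twists_comp_complex f g

/-- Two endomorphisms of an object of `D₀` whose composite is the identity have the same twist.
[cite: MochizukiFrdII2008, Def 3.1 (i) p.23] -/
theorem twists_eq_of_comp_eq_id {K : D0} (f g : K ⟶ K) (h : f ≫ g = 𝟙 K) :
    D0.Hom.twists f = D0.Hom.twists g := by
  cases K with
  | real => rw [D0.twists_of_real, D0.twists_of_real]
  | complex =>
    have h' := D0.twists_comp_complex f g
    rw [h, D0.twists_id] at h'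
    revert h'
    cases D0.Hom.twists f <;> cases D0.Hom.twists g <;> simp

/-- From `tF · t′ = t · tF` (twists of a commuting square into a complex object) to `t′ = t`.
[cite: MochizukiFrdII2008, Def 3.1 (i) p.23] -/
theorem bool_xor_cancel {a b c : Bool} (h : xor a b = xor c a) : b = c := by
  revert h; cases a <;> cases b <;> cases c <;> simp

/-- Complex conjugation is inversion on `S¹`: `unitCirc (z̄) = (unitCirc z)⁻¹` for `|z| = 1`.
[cite: MochizukiFrdII2008, Thm 3.6 (v) p.37] -/
theorem unitCirc_galAct_true {z : ℂˣ} (hz : ‖(z : ℂ)‖ = 1) :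
    unitCirc (D0.galAct true z) = (unitCirc z)⁻¹ :=
  Circle.ext (by
    rw [coe_unitCirc (by rw [D0.norm_galAct]; exact hz), Circle.coe_inv_eq_conj, coe_unitCirc hz,
      D0.galAct_true, Units.coe_star]
    rfl)

/-- The sign by which a twist acts on `S¹ ⊗_ℤ ℚ`: identity (`false`) or negation (`true`, complex
conjugation = inversion on `S¹`). [cite: MochizukiFrdII2008, Thm 3.6 (iv) p.37] -/
theorem ofMul_unitCirc_galAct (σ : Bool) {z : ℂˣ} (hz : ‖(z : ℂ)‖ = 1) (q : ℚ) :
    (Additive.ofMul (unitCirc (D0.galAct σ z)) ⊗ₜ[ℤ] q : Additive Circle ⊗[ℤ] ℚ) =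
      bif σ then -(Additive.ofMul (unitCirc z) ⊗ₜ[ℤ] q) else Additive.ofMul (unitCirc z) ⊗ₜ[ℤ] q := by
  cases σ with
  | false => rw [D0.galAct_false]; rfl
  | true => rw [unitCirc_galAct_true hz, ofMul_inv, TensorProduct.neg_tmul]; rfl

section Perfection

variable {D : Type u} [Category.{v} D] {π : D ⥤ D0}
variable {hF : PreFrobenioid.IsFrobenioid (C.toElem π)} (X : pfCat π hF)

open PreFrobenioid PreFrobenioid.Perfection

/-! ### Automorphisms of `(A, n)`: representatives, twists, conjugation of units -/

/-- Every automorphism of `(A, n)` is the class `[Θ]` of an automorphism `Θ` of some Frobenius power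
`A^{(c)}` ([FrdI] Prop. 3.2 (ii)). [cite: MochizukiFrdI2008, Prop. 3.2 (ii) p.59] -/
theorem exists_aut_rep (α : Aut X) :
    ∃ (c : ℕ+) (Θ : Aut (frobPow hF X.obj c)), classAut X c Θ = α := by
  obtain ⟨c, θ₀, hθ₀⟩ := exists_endClass_eq X α.hom
  have hiso : IsIso (X := X) (Y := X) (Hom.mk ⟨Level.diag X c, θ₀⟩) := by
    rw [← endClass_def, hθ₀]; infer_instance
  obtain ⟨N, hN, hI⟩ := exists_isIso_lift_of_isIso ⟨Level.diag X c, θ₀⟩ hiso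
  obtain ⟨a, b, hab⟩ := N
  obtain rfl : a = b := mul_left_cancel hab
  haveI : IsIso (Level.lift (Level.diag X c) ⟨a, a, hab⟩ hN θ₀) := hI
  have hcl : endClass X a (Level.lift (Level.diag X c) ⟨a, a, hab⟩ hN θ₀) = α.hom :=
    (endClass_liftLevel X hN.1 θ₀ _).trans hθ₀
  exact ⟨a, asIso (Level.lift (Level.diag X c) ⟨a, a, hab⟩ hN θ₀), Iso.ext hcl⟩

/-- The twist of (the base of the `C₀`-component of) an automorphism `Θ` of a Frobenius power `A^{(c)}`.
[cite: MochizukiFrdII2008, Def 3.1 (iv) p.24] -/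
def autTwist {c : ℕ+} (Θ : Aut (frobPow hF X.obj c)) : Bool := D0.Hom.twists (C0.Base Θ.hom.fst)

/-- The inverse has the same twist. [cite: MochizukiFrdII2008, Def 3.1 (i) p.23] -/
theorem twists_inv_fst {c : ℕ+} (Θ : Aut (frobPow hF X.obj c)) :
    D0.Hom.twists (C0.Base Θ.inv.fst) = autTwist X Θ := by
  refine twists_eq_of_comp_eq_id _ _ ?_
  rw [← C0.base_comp', ← CFP.comp_fst, Θ.inv_hom_id, CFP.id_fst, C0.base_id']

/-- Transport to a higher Frobenius power does not change the twist (complex `A`: the transition arrow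
commutes with `Θ` and its transport). [cite: MochizukiFrdII2008, Def 3.1 (iv) p.24] -/
theorem autTwist_liftUnit (hX : (π.obj X.obj.snd).IsComplex) {c c' : ℕ+} (h : c ∣ c')
    (Θ : Aut (frobPow hF X.obj c)) : autTwist X (liftUnit X h Θ) = autTwist X Θ := by
  have hsq := congrArg (fun f => D0.Hom.twists (C0.Base (CFP.Hom.fst f))) (frobTrans_liftUnit X h Θ)
  simp only [CFP.comp_fst, C0.base_comp'] at hsq
  rw [twists_comp_of_isComplex (isComplexObj_frobPow X hX c'),
    twists_comp_of_isComplex (isComplexObj_frobPow X hX c')] at hsq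
  exact bool_xor_cancel hsq

/-- The conjugate `Θ θ Θ⁻¹` of a unit `θ ∈ O^×(A^{(c)})` by an automorphism `Θ` of `A^{(c)}` is a unit.
[cite: MochizukiFrdII2008, Thm 3.6 (iv) p.37] -/
theorem conj_mem {c : ℕ+} (Θ θ : Aut (frobPow hF X.obj c))
    (hθ : θ ∈ unitsSubgroup (C.toElem π) (frobPow hF X.obj c)) :
    Θ * θ * Θ⁻¹ ∈ unitsSubgroup (C.toElem π) (frobPow hF X.obj c) := by
  have hm : θ.hom ∈ endSubmonoid (C.toElem π) (frobPow hF X.obj c) := hθ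
  obtain ⟨h1, -, h3⟩ := AutAction.conj_components Θ θ.hom hm
  exact ⟨h1, h3⟩

/-- Its scalar is the Galois twist of `Θ` applied to the scalar of `θ` (Ex. 3.3 (i) composition law).
[cite: MochizukiFrdII2008, Thm 3.6 (iv) p.37] -/
theorem scalar_conj {c : ℕ+} (Θ θ : Aut (frobPow hF X.obj c))
    (hθ : θ ∈ unitsSubgroup (C.toElem π) (frobPow hF X.obj c)) :
    C0.scalar (Θ * θ * Θ⁻¹).hom.fst = D0.galAct (autTwist X Θ) (C0.scalar θ.hom.fst) := by
  have hm : θ.hom ∈ endSubmonoid (C.toElem π) (frobPow hF X.obj c) := hθ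
  have h := AutAction.scalar_conj Θ θ.hom hm
  rw [← twists_inv_fst]
  exact h

/-- Hence its normalised scalar is the Galois twist of `Θ` applied to the normalised scalar of `θ`.
[cite: MochizukiFrdII2008, Thm 3.6 (iv) p.37] -/
theorem normScalar_conj {c : ℕ+} (Θ θ : Aut (frobPow hF X.obj c))
    (hθ : θ ∈ unitsSubgroup (C.toElem π) (frobPow hF X.obj c)) :
    normScalar X c (Θ * θ * Θ⁻¹) = D0.galAct (autTwist X Θ) (normScalar X c θ) := by
  rw [normScalar, scalar_conj X Θ θ hθ, normScalar, D0.galAct_comm]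

/-- **Conjugation by `Θ` acts on the values in `S¹ ⊗_ℤ ℚ` by the sign of its twist.**
[cite: MochizukiFrdII2008, Thm 3.6 (iv) p.37] -/
theorem levelVal_conj {c : ℕ+} (Θ θ : Aut (frobPow hF X.obj c))
    (hθ : θ ∈ unitsSubgroup (C.toElem π) (frobPow hF X.obj c)) :
    levelVal X c (Θ * θ * Θ⁻¹) =
      bif autTwist X Θ then -levelVal X c θ else levelVal X c θ := by
  unfold levelVal
  rw [normScalar_conj X Θ θ hθ, ofMul_unitCirc_galAct _ (norm_normScalar X c θ hθ)]

/-- `[Θ θ Θ⁻¹] = [Θ] [θ] [Θ]⁻¹`. [cite: MochizukiFrdI2008, Def. 3.1 (iii) p.57] -/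
theorem classAut_conj {c : ℕ+} (Θ θ : Aut (frobPow hF X.obj c)) :
    classAut X c (Θ * θ * Θ⁻¹) = classAut X c Θ * classAut X c θ * (classAut X c Θ)⁻¹ := by
  rw [classAut_mul, classAut_mul, show classAut X c Θ⁻¹ = (classAut X c Θ)⁻¹ from
    map_inv (classAutHom X c) Θ]

/-- `α⁻¹ ≪≫ u ≪≫ α = α u α⁻¹` in the group `Aut((A, n))`. [cite: MochizukiFrdII2008, Thm 3.6 (iv) p.37] -/
theorem symm_trans_trans_eq (α u : Aut X) : α.symm ≪≫ u ≪≫ α = α * u * α⁻¹ := by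
  simp only [Aut.Aut_mul_def, Aut.Aut_inv_def]

/-- Conjugates of units are units. [cite: MochizukiFrdII2008, Thm 3.6 (iv) p.37] -/
theorem conj_mem_pf (α : Aut X) (u : Aut X) (hu : u ∈ unitsSubgroup (pfStr π hF) X) :
    α.symm ≪≫ u ≪≫ α ∈ unitsSubgroup (pfStr π hF) X := by
  obtain ⟨c, Θ, hΘ⟩ := exists_aut_rep X α
  obtain ⟨c₁, θ, hθ, e⟩ := exists_unit_rep X u hu
  have h₁ : c ∣ c * c₁ := dvd_mul_right _ _
  have h₂ : c₁ ∣ c * c₁ := dvd_mul_left _ _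
  have hα : classAut X (c * c₁) (liftUnit X h₁ Θ) = α := by rw [classAut_liftUnit, hΘ]
  have hu' : classAut X (c * c₁) (liftUnit X h₂ θ) = u := by rw [classAut_liftUnit]; exact Iso.ext e
  rw [symm_trans_trans_eq, ← hα, ← hu', ← classAut_conj]
  exact classAut_mem X _ _ (conj_mem X _ _ (liftUnit_mem X h₂ θ hθ))

/-- **Conjugation by `α = [Θ]` acts on `unitVal` by the sign of the twist of `Θ`** (complex `A`).
[cite: MochizukiFrdII2008, Thm 3.6 (iv) p.37] -/
theorem unitVal_conj (hX : (π.obj X.obj.snd).IsComplex) (α : Aut X) {c : ℕ+}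
    (Θ : Aut (frobPow hF X.obj c)) (hΘ : classAut X c Θ = α) (u : unitsSubgroup (pfStr π hF) X) :
    unitVal X ⟨α.symm ≪≫ u.1 ≪≫ α, conj_mem_pf X α u.1 u.2⟩ =
      bif autTwist X Θ then -unitVal X u else unitVal X u := by
  obtain ⟨c₁, θ, hθ, e⟩ := exists_unit_rep X u.1 u.2
  have h₁ : c ∣ c * c₁ := dvd_mul_right _ _
  have h₂ : c₁ ∣ c * c₁ := dvd_mul_left _ _
  have hα : classAut X (c * c₁) (liftUnit X h₁ Θ) = α := by rw [classAut_liftUnit, hΘ]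
  have hu' : classAut X (c * c₁) (liftUnit X h₂ θ) = u.1 := by rw [classAut_liftUnit]; exact Iso.ext e
  have m₂ := liftUnit_mem X h₂ θ hθ
  have hconj : classAut X (c * c₁) (liftUnit X h₁ Θ * liftUnit X h₂ θ * (liftUnit X h₁ Θ)⁻¹) =
      α.symm ≪≫ u.1 ≪≫ α := by
    rw [classAut_conj, hα, hu', symm_trans_trans_eq]
  rw [unitVal_eq X _ _ (conj_mem X _ _ m₂) hconj, levelVal_conj X _ _ m₂, autTwist_liftUnit X hX h₁ Θ,
    unitVal_eq X u _ m₂ hu']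

/-- From the `C₀`-side base to the `D`-side base of an endomorphism of an object of `C` (the two are
intertwined by the object's identification `ι`). [cite: MochizukiFrdII2008, Ex 3.3 (i) p.28] -/
theorem map_snd_eq_of_base_fst_eq {Y : C π} (f g : Y ⟶ Y) (h : C0.Base f.fst = C0.Base g.fst) :
    π.map f.snd = π.map g.snd := by
  have h1 := f.w
  have h2 := g.w
  change C0.Base f.fst ≫ Y.iso.hom = Y.iso.hom ≫ π.map f.snd at h1
  change C0.Base g.fst ≫ Y.iso.hom = Y.iso.hom ≫ π.map g.snd at h2
  rw [h] at h1
  exact (cancel_epi Y.iso.hom).mp (h1.symm.trans h2)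

/-- If `α = [Θ]`, `α′ = [Θ′]` (one level) and `Θ`, `Θ′` have the same twist, then `α`, `α′` have the same
image in `Aut_{D₀}(X₀)`. [cite: MochizukiFrdII2008, Thm 3.6 (iv) p.37] -/
theorem mapIso_eq_of_autTwist_eq {c : ℕ+} (α α' : Aut X) (Θ Θ' : Aut (frobPow hF X.obj c))
    (hΘ : classAut X c Θ = α) (hΘ' : classAut X c Θ' = α') (ht : autTwist X Θ = autTwist X Θ') :
    (PreFrobenioid.baseFunctor (pfStr π hF) ⋙ baseRC π).mapIso α =
      (PreFrobenioid.baseFunctor (pfStr π hF) ⋙ baseRC π).mapIso α' := by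
  have hb : C0.Base Θ.hom.fst = C0.Base Θ'.hom.fst := AutAction.D0_endo_eq_of_twists_eq _ _ ht
  have hs : π.map Θ.hom.snd = π.map Θ'.hom.snd := map_snd_eq_of_base_fst_eq _ _ hb
  apply Iso.ext
  change (PreFrobenioid.baseFunctor (ops hF).toFunctor ⋙ (π ⋙ D0.toArchBase)).map α.hom =
    (PreFrobenioid.baseFunctor (ops hF).toFunctor ⋙ (π ⋙ D0.toArchBase)).map α'.hom
  rw [← hΘ, ← hΘ']
  change (PreFrobenioid.baseFunctor (ops hF).toFunctor ⋙ (π ⋙ D0.toArchBase)).map (endClass X c Θ.hom) =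
    (PreFrobenioid.baseFunctor (ops hF).toFunctor ⋙ (π ⋙ D0.toArchBase)).map (endClass X c Θ'.hom)
  change (π ⋙ D0.toArchBase).map (Base (C.toElem π) (frob hF X.obj c) ≫ Θ.hom.snd ≫ baseInvFrob hF X.obj c) =
    (π ⋙ D0.toArchBase).map (Base (C.toElem π) (frob hF X.obj c) ≫ Θ'.hom.snd ≫ baseInvFrob hF X.obj c)
  simp only [Functor.comp_map, Functor.map_comp]
  exact congrArg (fun x : π.obj (frobPow hF X.obj c).snd ⟶ π.obj (frobPow hF X.obj c).snd =>
    D0.toArchBase.map (π.map (Base (C.toElem π) (frob hF X.obj c))) ≫ D0.toArchBase.map x ≫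
      D0.toArchBase.map (π.map (baseInvFrob hF X.obj c))) hs

/-- **The twist of an automorphism is detected by its action on `O^×((A, n))`** (complex `A`): if
conjugation by `α = [Θ]` and by `α′ = [Θ′]` agree on `O^×((A, n))`, then `Θ`, `Θ′` have the same twist —
otherwise every `v ∈ S¹ ⊗_ℤ ℚ` in the image of `unitVal` satisfies `v = -v`, so every unit is `2`-torsion,
hence trivial (torsion-free), contradicting nontriviality. [cite: MochizukiFrdII2008, Thm 3.6 (iv) p.37] -/
theorem autTwist_eq_of_units (hX : (π.obj X.obj.snd).IsComplex) (α α' : Aut X) {c : ℕ+}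
    (Θ Θ' : Aut (frobPow hF X.obj c)) (hΘ : classAut X c Θ = α) (hΘ' : classAut X c Θ' = α')
    (hunits : ∀ u ∈ unitsSubgroup (pfStr π hF) X, α.symm ≪≫ u ≪≫ α = α'.symm ≪≫ u ≪≫ α') :
    autTwist X Θ = autTwist X Θ' := by
  by_contra hne
  apply unitsSubgroup_ne_bot_of_isComplex X hX
  refine (Subgroup.eq_bot_iff_forall _).mpr fun u hu => ?_
  have hv : unitVal X ⟨u, hu⟩ = -unitVal X ⟨u, hu⟩ := by
    have h1 := unitVal_conj X hX α Θ hΘ ⟨u, hu⟩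
    have h2 := unitVal_conj X hX α' Θ' hΘ' ⟨u, hu⟩
    have h12 : unitVal X ⟨α.symm ≪≫ u ≪≫ α, conj_mem_pf X α u hu⟩ =
        unitVal X ⟨α'.symm ≪≫ u ≪≫ α', conj_mem_pf X α' u hu⟩ := by
      congr 1
      exact Subtype.ext (hunits u hu)
    rw [h1, h2] at h12
    rcases Bool.eq_false_or_eq_true (autTwist X Θ) with ht | ht <;>
      rcases Bool.eq_false_or_eq_true (autTwist X Θ') with ht' | ht' <;>
      simp only [ht, ht', cond_true, cond_false] at h12
    · exact absurd (ht.trans ht'.symm) hne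
    · exact h12.symm
    · exact h12
    · exact absurd (ht.trans ht'.symm) hne
  have h2 : unitVal X (⟨u, hu⟩ * ⟨u, hu⟩) = 0 := by
    rw [unitVal_mul]
    nth_rewrite 1 [hv]
    exact neg_add_cancel _
  have h3 : (⟨u, hu⟩ : unitsSubgroup (pfStr π hF) X) * ⟨u, hu⟩ = 1 := eq_one_of_unitVal_eq_zero X _ h2
  have hfin : IsOfFinOrder (⟨u, hu⟩ : unitsSubgroup (pfStr π hF) X) :=
    isOfFinOrder_iff_pow_eq_one.mpr ⟨2, two_pos, by rw [pow_two]; exact h3⟩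
  exact congrArg Subtype.val (eq_one_of_isOfFinOrder X ⟨u, hu⟩ hfin)

end Perfection

/-! ### Theorem 3.6 (iv), second sentence, for `C^ℚ` -/

variable {D : Type u} [Category.{v} D] (π : D ⥤ D0)

open PreFrobenioid PreFrobenioid.Perfection

/-- **Repaired reading (3) of Thm. 3.6 (iv), second sentence, for `C^ℚ := C^pf`** (PROVED over THE
perfection): automorphisms `α, α′` of `X = (A, n)` acting identically on `O^▷(X)` and on `O^×(X)` have the
same image in `Aut_{D₀}(X₀)` — for `A` real because `Aut_{D₀}(Spec ℝ)` is trivial, for `A` complex because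
the image is read off from the action on `O^×(X) ≅ S¹ ⊗_ℤ ℚ` (`autTwist_eq_of_units`).
[cite: MochizukiFrdII2008, Thm 3.6 (iv) p.37] -/
theorem faithful_of_isIsotropic_Q (hF : PreFrobenioid.IsFrobenioid (C.toElem π)) :
    Thm36iv_faithful_of_isIsotropic (baseRC π) (pfStr π hF) .Q := by
  intro _ X _ α α' _ hunits
  rcases D0.isReal_or_isComplex (π.obj X.obj.snd) with hr | hc
  · apply Iso.ext
    change D0.toArchBase.map (π.map ((ops hF).base.map α.hom)) =
      D0.toArchBase.map (π.map ((ops hF).base.map α'.hom))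
    exact congrArg D0.toArchBase.map (D0_endo_eq_of_isReal hr _ _)
  · obtain ⟨c₁, Θ₁, h₁⟩ := exists_aut_rep X α
    obtain ⟨c₂, Θ₂, h₂⟩ := exists_aut_rep X α'
    have d₁ : c₁ ∣ c₁ * c₂ := dvd_mul_right _ _
    have d₂ : c₂ ∣ c₁ * c₂ := dvd_mul_left _ _
    have hΘ : classAut X (c₁ * c₂) (liftUnit X d₁ Θ₁) = α := by rw [classAut_liftUnit, h₁]
    have hΘ' : classAut X (c₁ * c₂) (liftUnit X d₂ Θ₂) = α' := by rw [classAut_liftUnit, h₂]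
    exact mapIso_eq_of_autTwist_eq X α α' _ _ hΘ hΘ'
      (autTwist_eq_of_units X hc α α' _ _ hΘ hΘ' hunits)

/-- **Thm. 3.6 (iv), second sentence — both repaired readings — for `C^ℚ := C^pf`** (PROVED over THE
perfection): reading (3) `faithful_of_isIsotropic_Q` and reading (1) by abc-iut-w4-d103's generic
`thm36iv_faithful_istr_of_faithful_of_isIsotropic`. Closes the slot `Thm36Sub.ivReadings_Q` (for every
value of its parameter `hF`). [cite: MochizukiFrdII2008, Thm 3.6 (iv) p.37] -/
theorem ivReadings_Q_holds (hF : PreFrobenioid.IsFrobenioid (C.toElem π)) :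
    Literature.AlgebraicGeometry.Frobenioids.ArchFrd.Thm36Sub.ivReadings_Q π hF :=
  ⟨faithful_of_isIsotropic_Q π hF,
    thm36iv_faithful_istr_of_faithful_of_isIsotropic (faithful_of_isIsotropic_Q π hF)⟩

/-- Hence abc-iut-L1-t9's instance `Thm36iv_readings_CA π (pfCompletion hF) rlf` holds IN FULL (its only
residue was reading (3) for the perfection datum, `thm36iv_readings_CA_of_pf`).
[cite: MochizukiFrdII2008, Thm 3.6 (iv) p.37] -/
theorem thm36iv_readings_CA_pfCompletion (hF : PreFrobenioid.IsFrobenioid (C.toElem π))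
    (rlf : LambdaCompletion π) : Thm36iv_readings_CA π (pfCompletion π hF) rlf :=
  thm36iv_readings_CA_of_pf π (pfCompletion π hF) rlf (faithful_of_isIsotropic_Q π hF)

end Thm36Sub

end ArchFrd

end Literature.AlgebraicGeometry.Frobenioids

end
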